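import Mathlib.GroupTheory.Perm.Fin
import Literature.Computability.AlgebraicComplexity.ValiantConjectureProofs
import Literature.Computability.AlgebraicComplexity.StandardFamiliesProofs
import HarnessLib

/-!
# `HC ∈ VNP`: discharge of `Literature.Computability.AlgebraicComplexity.isVNPFamily_hcPoly`

D-0014 keeps `Literature/` sorry-free by stating cited results as named facts `def X : Prop`.
This sibling file of `Literature.Computability.AlgebraicComplexity.ValiantConjecture` proves
Valiant's theorem that the Hamiltonian cycle family is p-definable,

* `isVNPFamily_hcPoly_holds : isVNPFamily_hcPoly k` (`IsVNPFamily (HC_n)_n`, the named fact of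
  `ValiantConjecture.lean`, membership half of the `VNP`-completeness of `HC`),
* `hcFamily_mem_VNP : hcFamily k ∈ VNP k`,

over every field `k` (in fact over every commutative ring, `isVNPFamily_hcPoly_of_commRing`),
in the same format as the permanent (`ValiantConjectureProofs.lean`). The p-family half is
`isPFamily_hcPoly_holds` (`StandardFamiliesProofs.lean`).

## The printed proof and the one formalised

Bürgisser–Clausen–Shokrollahi 1997, Prop. (21.15) ("PER and HC belong to VNP", pp. 548–549)
writes `HC_n = ∑_{e ∈ {0,1}^{n×n}} G_n(X, e)` with `G_n(X, Y) = γ_n(Y) ε_n(Y) μ_n(X, Y)`: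
`γ_n = α_n β_n`, `α_n = ∏ (1 - Y_{ij} Y_{ℓm})` over the pairs with (`i = ℓ` iff `j ≠ m`),
`β_n = ∏_i ∑_j Y_{ij}`, recognises permutation matrices ((A): `γ_n(e) ≠ 0` iff `e` is a
permutation matrix; (B): `γ_n(e) ∈ {0, 1}`); `ε_n(Y) = ∏_{1 ≤ q < n} (1 - (Y^q)_{11})`
recognises the `n`-cycles among them ("`π` is an `n`-cycle iff `π^q(1) ≠ 1` for all
`1 ≤ q < n`") and is computed by the straight-line iteration `C_1(Y^j) = Y · C_1(Y^{j-1})`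
with `L(ε_n) = O(n³)`; `μ_n = ∏_i ∑_j X_{ij} Y_{ij}` is the cover product.

The cost calculus available for `complexity` (`ArithCircuitProofs.lean`: `L(f + g), L(f g) ≤
L(f) + L(g) + 1` and the iterated forms) bounds *formulas*, without the sharing that the
iteration for `ε_n` needs. We therefore replace the iteration by its Boolean *transcript*: the
Boolean variables are a position matrix `Z ∈ {0,1}^{n×n}`, `Z_{(t,i)} = [π^t(0) = i]` ("the
vertex in position `t` of the cycle through `0` is `i`"), i.e. the permutation matrix of the
ordering `σ = (0, π(0), π²(0), …)` rather than of `π` itself. On `Z` we use BCS's recogniser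
literally (`hcVNPAlpha` = `α_n`, over `conflictPairs`; `hcVNPBeta` = `β_n`; (A)–(B) are
`recogniser_permGraph`, `recogniser_eq_zero`, (D) is `sum_recogniser_mul`), the factor
`Z_{(0,0)}` normalises the ordering to start at `0`, and the cover product becomes
`hcVNPCover = ∏_t ∑_{i,j} Z_{(t,i)} Z_{(t+1,j)} X_{(j,i)}`, which at the position matrix of `σ`
is the cycle monomial `∏_t X_{σ(t+1), σ(t)} = ∏_i X_{π i, i}` for `π = σ ∘ (+1) ∘ σ⁻¹`
(`cycleOfOrdering`). The orderings `σ` with `σ 0 = 0` correspond bijectively to the `n`-cycles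
(`hamiltonianCycleSum_eq_sum_orderings`: conjugates of `finRotate n` have cycle type `{n}`,
`Equiv.Perm.cycleType_conj`; every `n`-cycle is such a conjugate,
`Equiv.Perm.isConj_iff_cycleType_eq`, normalised by a power of the cycle; and the centraliser
of the `n`-cycle is the cyclic group it generates), which is BCS's orbit description
`1, π(1), …, π^{n-1}(1)` of an `n`-cycle. Hence (`boolSum_hcVNPWitness`)

  `∑_{e ∈ {0,1}^{n×n}} G(X, e) = ∑_{σ ∈ 𝔖_n, σ 0 = 0} ∏_t X_{σ(t+1), σ t} = HC_n(X)` (`n ≥ 2`),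

with `HC_n = ∑_{π : cycleType π = {n}} ∏_i X_{π i, i}` as in `StandardFamilies.lean` (the tree's
`hcPoly` sums `∏ X_{π i, i}`, BCS `∏ X_{i, π i}`; `π ↦ π⁻¹` identifies the two). For `n ≤ 1` no
permutation has cycle type `{n}` and `HC_n = 0` (`hcPoly_fin_eq_zero_of_le_one`), so the witness
family `hcVNPFamily` is `0` there. The witness has `2n²` variables, degree `≤ 7n⁴` and
complexity `≤ 8n⁴` (BCS: `O(n³)`; the extra factor comes from the `O(n⁴)` ordered conflicting
pairs in `α_n`, harmless for `VP`), in the cost model of BCS Def. (21.3) with Convention (21.5)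
(division- and subtraction-free, inputs and constants free; `1 - Z Z'` is computed as
`1 + (-1)·(Z Z')`), so `hcVNPFamily ∈ VP` (`isVPFamily_hcVNPFamily`) and `HC ∈ VNP` is literally
Bürgisser 2000, Def. 2.5 = `IsVNPFamily` (BCS Def. (21.8)), with Boolean block `Fin (n·n)`
(the position matrix enumerated by `finProdFinEquiv`). Mathlib has no Hamiltonian cycle
polynomial or Valiant classes (searched `hamiltonian`, `VNP`); reused: `finRotate`,
`Equiv.Perm.cycleType_conj`, `Equiv.Perm.isConj_iff_cycleType_eq`, `cycleType_finRotate`,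
`finCycle_eq_finRotate_iterate`, `finProdFinEquiv`.

## References

* L. G. Valiant, *Completeness classes in algebra*, Proc. 11th STOC (1979), 249–261.
* P. Bürgisser, M. Clausen, M. A. Shokrollahi, *Algebraic Complexity Theory*, Grundlehren 315,
  Springer 1997, Def. (21.3), Convention (21.5), Def. (21.8) pp. 546–547, Prop. (21.15)
  pp. 548–549.
* P. Bürgisser, *Completeness and Reduction in Algebraic Complexity Theory*, Springer 2000,
  Def. 2.5, Thm. 2.10, §2.1 (2.3).
-/

noncomputable section

open MvPolynomial Equiv

universe u

namespace Literature.Computability.AlgebraicComplexity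

/-! ### `n`-cycles as conjugates of the standard cycle by orderings fixing `0` -/

section CycleBijection

/-- Powers of the standard cycle act by addition: `(finRotate n)^t (i) = i + t`
(`finCycle_eq_finRotate_iterate`). [folklore] -/
theorem finRotate_pow_val_apply {n : ℕ} (t i : Fin n) :
    ((finRotate n) ^ (t : ℕ)) i = i + t := by
  rw [Perm.coe_pow, ← finCycle_eq_finRotate_iterate, finCycle_apply]

variable {m : ℕ}

/-- The `(m+2)`-cycle `σ ∘ (t ↦ t + 1) ∘ σ⁻¹` attached to an ordering `σ` of `Fin (m+2)`
(`σ t` = the vertex in position `t`): it maps `σ t` to `σ (t + 1)` (BCS 1997, proof of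
Prop. (21.15): an `n`-cycle `π` is the orbit `1, π(1), π²(1), …`). [cite: BurgisserClausenShokrollahi1997, Prop. (21.15)] -/
def cycleOfOrdering (σ : Perm (Fin (m + 2))) : Perm (Fin (m + 2)) :=
  σ * finRotate (m + 2) * σ⁻¹

/-- `cycleOfOrdering σ` is an `(m+2)`-cycle (conjugate of `finRotate`). [folklore] -/
theorem cycleType_cycleOfOrdering (σ : Perm (Fin (m + 2))) :
    (cycleOfOrdering σ).cycleType = {m + 2} := by
  rw [cycleOfOrdering, Perm.cycleType_conj, cycleType_finRotate]

/-- `cycleOfOrdering σ` maps the vertex in position `t` to the vertex in position `t + 1`. [folklore] -/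
theorem cycleOfOrdering_apply_self (σ : Perm (Fin (m + 2))) (t : Fin (m + 2)) :
    cycleOfOrdering σ (σ t) = σ (finRotate (m + 2) t) := by
  simp [cycleOfOrdering, Perm.mul_apply]

/-- Every `(m+2)`-cycle is `cycleOfOrdering σ` for an ordering `σ` starting at `0`
(conjugacy of permutations of equal cycle type, normalised by a power of the cycle). [folklore] -/
theorem exists_cycleOfOrdering_eq {π : Perm (Fin (m + 2))} (hπ : π.cycleType = {m + 2}) :
    ∃ σ : Perm (Fin (m + 2)), σ 0 = 0 ∧ cycleOfOrdering σ = π := by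
  have hc : IsConj (finRotate (m + 2)) π := by
    rw [Perm.isConj_iff_cycleType_eq, cycleType_finRotate, hπ]
  obtain ⟨c, hc⟩ := isConj_iff.1 hc
  refine ⟨c * finRotate (m + 2) ^ ((c⁻¹ 0 : Fin (m + 2)) : ℕ), ?_, ?_⟩
  · rw [Perm.mul_apply, finRotate_pow_val_apply, zero_add, Perm.coe_inv,
      Equiv.apply_symm_apply]
  · rw [cycleOfOrdering, ← hc, mul_inv_rev, ← mul_assoc,
      mul_assoc c (finRotate (m + 2) ^ _) (finRotate (m + 2)), ← pow_succ, pow_succ',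
      ← mul_assoc c, mul_inv_cancel_right]

/-- Two orderings starting at `0` with the same attached cycle coincide (the centraliser of an
`n`-cycle is the cyclic group it generates). [folklore] -/
theorem eq_of_cycleOfOrdering_eq {σ σ' : Perm (Fin (m + 2))} (h0 : σ 0 = 0) (h0' : σ' 0 = 0)
    (h : cycleOfOrdering σ = cycleOfOrdering σ') : σ = σ' := by
  have hu : Commute (σ'⁻¹ * σ) (finRotate (m + 2)) := by
    have h1 := congrArg (fun τ => σ'⁻¹ * τ * σ) h
    simp only [cycleOfOrdering] at h1
    rw [Commute, SemiconjBy]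
    calc σ'⁻¹ * σ * finRotate (m + 2) = σ'⁻¹ * (σ * finRotate (m + 2) * σ⁻¹) * σ := by group
      _ = σ'⁻¹ * (σ' * finRotate (m + 2) * σ'⁻¹) * σ := h1
      _ = finRotate (m + 2) * (σ'⁻¹ * σ) := by group
  have hu0 : (σ'⁻¹ * σ) 0 = 0 := by
    rw [Perm.mul_apply, h0, Perm.inv_eq_iff_eq, h0']
  have key : ∀ t : Fin (m + 2), (σ'⁻¹ * σ) t = t := by
    intro t
    have ht : ((finRotate (m + 2)) ^ (t : ℕ)) 0 = t := by
      rw [finRotate_pow_val_apply, zero_add]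
    have h2 := congrArg (fun τ : Perm (Fin (m + 2)) => τ 0) (hu.pow_right (t : ℕ)).eq
    simp only [Perm.mul_apply, hu0, ht] at h2
    exact h2
  have h3 : σ'⁻¹ * σ = 1 := Equiv.ext fun t => by rw [key t]; rfl
  exact ((inv_mul_eq_one.1 h3).symm)

/-- **The Hamiltonian cycle sum over orderings.** For an `(m+2) × (m+2)` matrix `M`,
`HC(M) = ∑_{π an (m+2)-cycle} ∏ᵢ M (π i) i = ∑_{σ ∈ 𝔖, σ 0 = 0} ∏ₜ M (σ (t+1)) (σ t)`:
Hamiltonian cycles correspond bijectively to orderings of the vertices starting at the vertex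
`0` (BCS 1997, proof of Prop. (21.15)). [cite: BurgisserClausenShokrollahi1997, Prop. (21.15)] -/
theorem hamiltonianCycleSum_eq_sum_orderings {R : Type*} [CommSemiring R]
    (M : Matrix (Fin (m + 2)) (Fin (m + 2)) R) :
    M.hamiltonianCycleSum = ∑ σ ∈ Finset.univ.filter (fun σ : Perm (Fin (m + 2)) => σ 0 = 0),
      ∏ t, M (σ (finRotate (m + 2) t)) (σ t) := by
  unfold Matrix.hamiltonianCycleSum
  simp only [Fintype.card_fin]
  symm
  refine Finset.sum_nbij cycleOfOrdering ?_ ?_ ?_ ?_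
  · intro σ _
    simp [cycleType_cycleOfOrdering]
  · intro σ hσ σ' hσ' h
    simp only [Finset.coe_filter, Set.mem_setOf_eq, Finset.mem_univ, true_and] at hσ hσ'
    exact eq_of_cycleOfOrdering_eq hσ hσ' h
  · intro π hπ
    simp only [Finset.coe_filter, Set.mem_setOf_eq, Finset.mem_univ, true_and] at hπ
    obtain ⟨σ, h0, rfl⟩ := exists_cycleOfOrdering_eq hπ
    exact ⟨σ, by simp [h0], rfl⟩
  · intro σ _
    exact Fintype.prod_equiv σ _ _ fun t => by rw [cycleOfOrdering_apply_self]

end CycleBijection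

/-! ### The permutation-matrix recogniser on Boolean points -/

section Recogniser

variable {N : ℕ}

/-- The conflicting (ordered) pairs of positions of an `N × N` Boolean matrix: distinct
positions in the same row or in the same column (the index set of BCS's
`α_n = ∏ (1 - Y_{ij} Y_{ℓm})`, product over `i = ℓ` iff `j ≠ m`; BCS 1997, proof of
Prop. (21.15)). [cite: BurgisserClausenShokrollahi1997, Prop. (21.15)] -/
def conflictPairs (N : ℕ) : Finset ((Fin N × Fin N) × (Fin N × Fin N)) :=
  Finset.univ.filter fun pq => pq.1 ≠ pq.2 ∧ (pq.1.1 = pq.2.1 ∨ pq.1.2 = pq.2.2)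

/-- There are at most `N⁴` conflicting pairs. [folklore] -/
theorem card_conflictPairs_le (N : ℕ) : (conflictPairs N).card ≤ N ^ 4 := by
  refine (Finset.card_filter_le _ _).trans ?_
  simp only [Finset.card_univ, Fintype.card_prod, Fintype.card_fin]
  exact le_of_eq (by ring)

/-- The permutation matrix of `σ` as a Boolean matrix, entry `(t, i)` being `[σ t = i]`
(BCS 1997, proof of Prop. (21.15): "the permutation corresponding to `e`"). [cite: BurgisserClausenShokrollahi1997, Prop. (21.15)] -/
def permGraph (σ : Perm (Fin N)) : Fin N × Fin N → Bool := fun p => decide (σ p.1 = p.2)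

/-- A permutation is determined by its permutation matrix. [folklore] -/
theorem permGraph_injective : Function.Injective (permGraph (N := N)) := by
  intro σ σ' h
  refine Equiv.ext fun t => ?_
  have h1 := congrFun h (t, σ t)
  simp only [permGraph, decide_true, true_eq_decide_iff] at h1
  exact h1.symm

/-- BCS 1997, proof of Prop. (21.15), (A)–(B) at a permutation matrix: the recogniser
`γ = α · β` takes the value `1`. [cite: BurgisserClausenShokrollahi1997, Prop. (21.15)] -/
theorem recogniser_permGraph {R : Type*} [CommRing R] (σ : Perm (Fin N)) :
    (∏ pq ∈ conflictPairs N, (1 - (if permGraph σ pq.1 then (1 : R) else 0) *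
        (if permGraph σ pq.2 then (1 : R) else 0))) *
      (∏ t, ∑ i, (if permGraph σ (t, i) then (1 : R) else 0)) = 1 := by
  have hα : ∀ pq ∈ conflictPairs N, (1 - (if permGraph σ pq.1 then (1 : R) else 0) *
      (if permGraph σ pq.2 then (1 : R) else 0)) = 1 := by
    rintro ⟨p, q⟩ hpq
    simp only [conflictPairs, Finset.mem_filter, Finset.mem_univ, true_and] at hpq
    obtain ⟨hne, hrc⟩ := hpq
    have hnot : ¬ (permGraph σ p = true ∧ permGraph σ q = true) := by
      simp only [permGraph, decide_eq_true_eq]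
      rintro ⟨hp, hq⟩
      apply hne
      rcases hrc with h | h
      · exact Prod.ext h (by rw [← hp, ← hq, h])
      · refine Prod.ext (σ.injective ?_) h
        rw [hp, hq, h]
    by_cases hp : permGraph σ p = true
    · by_cases hq : permGraph σ q = true
      · exact absurd ⟨hp, hq⟩ hnot
      · simp [hq]
    · simp [hp]
  have hβ : ∀ t, (∑ i, (if permGraph σ (t, i) then (1 : R) else 0)) = 1 := by
    intro t
    simp [permGraph, Finset.sum_ite_eq]
  rw [Finset.prod_eq_one hα, Finset.prod_eq_one (fun t _ => hβ t), one_mul]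

/-- BCS 1997, proof of Prop. (21.15), (A)–(B) away from permutation matrices: the recogniser
`γ = α · β` vanishes at every Boolean matrix that is not a permutation matrix. [cite: BurgisserClausenShokrollahi1997, Prop. (21.15)] -/
theorem recogniser_eq_zero {R : Type*} [CommRing R] {E : Fin N × Fin N → Bool}
    (hE : ∀ σ : Perm (Fin N), permGraph σ ≠ E) :
    (∏ pq ∈ conflictPairs N, (1 - (if E pq.1 then (1 : R) else 0) *
        (if E pq.2 then (1 : R) else 0))) *
      (∏ t, ∑ i, (if E (t, i) then (1 : R) else 0)) = 0 := by
  classical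
  by_cases h1 : ∃ pq ∈ conflictPairs N, E pq.1 = true ∧ E pq.2 = true
  · obtain ⟨pq, hpq, hp, hq⟩ := h1
    rw [Finset.prod_eq_zero hpq (by simp [hp, hq]), zero_mul]
  push Not at h1
  by_cases h2 : ∃ t, ∀ i, E (t, i) = false
  · obtain ⟨t, ht⟩ := h2
    rw [Finset.prod_eq_zero (Finset.mem_univ t) (by simp [ht]), mul_zero]
  push Not at h2
  exfalso
  choose v hv using h2
  have hv' : ∀ t, E (t, v t) = true := fun t => by simpa using hv t
  have hrow : ∀ t i, E (t, i) = true → i = v t := by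
    intro t i hi
    by_contra hne
    have hmem : ((t, i), (t, v t)) ∈ conflictPairs N :=
      Finset.mem_filter.2 ⟨Finset.mem_univ _, fun h => hne (Prod.ext_iff.1 h).2, Or.inl rfl⟩
    exact h1 _ hmem hi (hv' t)
  have hinj : Function.Injective v := by
    intro t t' htt
    by_contra hne
    have hmem : ((t, v t), (t', v t')) ∈ conflictPairs N :=
      Finset.mem_filter.2 ⟨Finset.mem_univ _, fun h => hne (Prod.ext_iff.1 h).1, Or.inr htt⟩
    exact h1 _ hmem (hv' t) (hv' t')
  apply hE (Equiv.ofBijective v (Finite.injective_iff_bijective.1 hinj))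
  funext ⟨t, i⟩
  simp only [permGraph, Equiv.ofBijective_apply]
  by_cases hi : E (t, i) = true
  · rw [hi]
    simp only [decide_eq_true_eq]
    exact (hrow t i hi).symm
  · rw [Bool.not_eq_true] at hi
    rw [hi, decide_eq_false_iff_not]
    intro h
    rw [← h, hv'] at hi
    exact Bool.noConfusion hi

/-- **Boolean sums against the recogniser are sums over permutation matrices**
(BCS 1997, proof of Prop. (21.15), (A), (B), (D)): for any weight `G`,
`∑_{E ∈ {0,1}^{N×N}} α(E) β(E) G(E) = ∑_{σ ∈ 𝔖_N} G(P_σ)`. [cite: BurgisserClausenShokrollahi1997, Prop. (21.15)] -/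
theorem sum_recogniser_mul {R : Type*} [CommRing R] (G : (Fin N × Fin N → Bool) → R) :
    ∑ E : Fin N × Fin N → Bool,
      (∏ pq ∈ conflictPairs N, (1 - (if E pq.1 then (1 : R) else 0) *
          (if E pq.2 then (1 : R) else 0))) *
        (∏ t, ∑ i, (if E (t, i) then (1 : R) else 0)) * G E =
      ∑ σ : Perm (Fin N), G (permGraph σ) := by
  classical
  have h : ∀ E : Fin N × Fin N → Bool,
      (∏ pq ∈ conflictPairs N, (1 - (if E pq.1 then (1 : R) else 0) *
          (if E pq.2 then (1 : R) else 0))) *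
        (∏ t, ∑ i, (if E (t, i) then (1 : R) else 0)) * G E =
      if ∃ σ : Perm (Fin N), permGraph σ = E then G E else 0 := by
    intro E
    split_ifs with hσ
    · obtain ⟨σ, rfl⟩ := hσ
      rw [recogniser_permGraph, one_mul]
    · push Not at hσ
      rw [recogniser_eq_zero hσ, zero_mul]
  rw [Finset.sum_congr rfl fun E _ => h E, ← Finset.sum_filter]
  have hfi : (Finset.univ.filter fun E : Fin N × Fin N → Bool =>
      ∃ σ : Perm (Fin N), permGraph σ = E) = Finset.univ.image permGraph := by
    ext E
    simp
  rw [hfi, Finset.sum_image fun σ _ σ' _ h => permGraph_injective h]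

end Recogniser

/-! ### Cost and degree of the elementary factors -/

section Costs

variable {k : Type u} [CommRing k] {σ : Type*}

/-- `deg (1 - X_s X_{s'}) ≤ 2`. [folklore] -/
theorem totalDegree_one_sub_X_mul_X_le (s s' : σ) :
    (1 - X s * X s' : MvPolynomial σ k).totalDegree ≤ 2 := by
  refine (totalDegree_sub _ _).trans (max_le ?_ ?_)
  · rw [totalDegree_one]; exact Nat.zero_le _
  · exact (totalDegree_mul _ _).trans
      (add_le_add (totalDegree_X_le_one _) (totalDegree_X_le_one _))

/-- `deg (X_a X_b X_c) ≤ 3`. [folklore] -/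
theorem totalDegree_X_mul_X_mul_X_le (a b c : σ) :
    (X a * X b * X c : MvPolynomial σ k).totalDegree ≤ 3 :=
  (totalDegree_mul _ _).trans (add_le_add ((totalDegree_mul _ _).trans
    (add_le_add (totalDegree_X_le_one _) (totalDegree_X_le_one _))) (totalDegree_X_le_one _))

/-- `L(1 - X_s X_{s'}) ≤ 3`: `1 - X_s X_{s'} = 1 + (-1) · (X_s · X_{s'})`, one multiplication of
inputs, one by the constant `-1`, one addition (BCS 1997, Def. (21.3), Convention (21.5): inputs
and constants are free). [cite: BurgisserClausenShokrollahi1997, Def. (21.3)] -/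
theorem complexity_one_sub_X_mul_X_le (s s' : σ) :
    complexity (1 - X s * X s' : MvPolynomial σ k) ≤ 3 := by
  have he : (1 - X s * X s' : MvPolynomial σ k) = C 1 + C (-1) * (X s * X s') := by
    rw [map_neg, map_one, neg_one_mul, sub_eq_add_neg]
  rw [he]
  have h1 := complexity_add_le_holds (C 1 : MvPolynomial σ k) (C (-1) * (X s * X s'))
  have h2 := complexity_mul_le_holds (C (-1) : MvPolynomial σ k) (X s * X s')
  have h3 := complexity_mul_le_holds (X s : MvPolynomial σ k) (X s')
  have h4 := complexity_C_holds (σ := σ) (1 : k)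
  have h5 := complexity_C_holds (σ := σ) (-1 : k)
  have h6 := complexity_X_holds (k := k) s
  have h7 := complexity_X_holds (k := k) s'
  omega

/-- `L(X_a X_b X_c) ≤ 2` (two multiplications; BCS 1997, Def. (21.3), Convention (21.5)). [cite: BurgisserClausenShokrollahi1997, Def. (21.3)] -/
theorem complexity_X_mul_X_mul_X_le (a b c : σ) :
    complexity (X a * X b * X c : MvPolynomial σ k) ≤ 2 := by
  have h1 := complexity_mul_le_holds (X a * X b : MvPolynomial σ k) (X c)
  have h2 := complexity_mul_le_holds (X a : MvPolynomial σ k) (X b)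
  have h3 := complexity_X_holds (k := k) a
  have h4 := complexity_X_holds (k := k) b
  have h5 := complexity_X_holds (k := k) c
  omega

/-- Degree of a sum with uniformly bounded summands. [folklore] -/
theorem totalDegree_sum_le_of_le {R : Type*} [CommSemiring R] {ι : Type*} (s : Finset ι)
    (f : ι → MvPolynomial σ R) (b : ℕ) (h : ∀ i ∈ s, (f i).totalDegree ≤ b) :
    (∑ i ∈ s, f i).totalDegree ≤ b :=
  (totalDegree_finsetSum _ _).trans (Finset.sup_le h)

/-- Degree of a product with uniformly bounded factors. [folklore] -/
theorem totalDegree_prod_le_of_le {R : Type*} [CommSemiring R] {ι : Type*} (s : Finset ι)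
    (f : ι → MvPolynomial σ R) (b : ℕ) (h : ∀ i ∈ s, (f i).totalDegree ≤ b) :
    (∏ i ∈ s, f i).totalDegree ≤ s.card * b :=
  (totalDegree_finsetProd _ _).trans ((Finset.sum_le_sum h).trans
    (by rw [Finset.sum_const, smul_eq_mul]))

/-- `L(∑_{i ∈ s} fᵢ) ≤ #s · b + #s` when `L(fᵢ) ≤ b` (`complexity_finset_sum_le`;
BCS 1997, (21.4)). [cite: BurgisserClausenShokrollahi1997, (21.4)] -/
theorem complexity_sum_le_of_le {R : Type*} [CommSemiring R] {ι : Type*} (s : Finset ι)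
    (f : ι → MvPolynomial σ R) (b : ℕ) (h : ∀ i ∈ s, complexity (f i) ≤ b) :
    complexity (∑ i ∈ s, f i) ≤ s.card * b + s.card :=
  (complexity_finset_sum_le s f).trans (Nat.add_le_add_right ((Finset.sum_le_sum h).trans
    (by rw [Finset.sum_const, smul_eq_mul])) _)

/-- `L(∏_{i ∈ s} fᵢ) ≤ #s · b + #s` when `L(fᵢ) ≤ b` (`complexity_finset_prod_le`;
BCS 1997, (21.4)). [cite: BurgisserClausenShokrollahi1997, (21.4)] -/
theorem complexity_prod_le_of_le {R : Type*} [CommSemiring R] {ι : Type*} (s : Finset ι)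
    (f : ι → MvPolynomial σ R) (b : ℕ) (h : ∀ i ∈ s, complexity (f i) ≤ b) :
    complexity (∏ i ∈ s, f i) ≤ s.card * b + s.card :=
  (complexity_finset_prod_le s f).trans (Nat.add_le_add_right ((Finset.sum_le_sum h).trans
    (by rw [Finset.sum_const, smul_eq_mul])) _)

end Costs

/-! ### The `VNP` witness for `HC_{m+2}` -/

section Witness

variable (m : ℕ) (k : Type u) [CommRing k]

/-- The variables of the witness for `HC_{m+2}`: the `(m+2)²` matrix variables `X_{(j,i)}`
(`Sum.inl`) and `(m+2)²` Boolean position variables `Z_p = X (Sum.inr (finProdFinEquiv p))`,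
`p = (t, i)` ("the vertex in position `t` of the cycle is `i`"), enumerated by
`Fin ((m+2)(m+2))` as `IsVNPFamily` requires. [cite: BurgisserClausenShokrollahi1997, Prop. (21.15)] -/
abbrev HCVars : Type :=
  (Fin (m + 2) × Fin (m + 2)) ⊕ Fin ((m + 2) * (m + 2))

/-- BCS's `α_n` on the position variables: `∏ (1 - Z_p Z_q)` over the conflicting pairs
(BCS 1997, proof of Prop. (21.15)). [cite: BurgisserClausenShokrollahi1997, Prop. (21.15)] -/
def hcVNPAlpha : MvPolynomial (HCVars m) k :=
  ∏ pq ∈ conflictPairs (m + 2),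
    (1 - X (Sum.inr (finProdFinEquiv pq.1)) * X (Sum.inr (finProdFinEquiv pq.2)))

/-- BCS's `β_n` on the position variables: `∏_t ∑_i Z_{(t,i)}`
(BCS 1997, proof of Prop. (21.15)). [cite: BurgisserClausenShokrollahi1997, Prop. (21.15)] -/
def hcVNPBeta : MvPolynomial (HCVars m) k :=
  ∏ t : Fin (m + 2), ∑ i : Fin (m + 2), X (Sum.inr (finProdFinEquiv (t, i)))

/-- The cover polynomial `∏_t ∑_{i,j} Z_{(t,i)} Z_{(t+1,j)} X_{(j,i)}` (the rôle of BCS's `μ_n`: at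
the position matrix of an ordering `σ` it is the cycle monomial `∏_t X_{σ(t+1), σ t}`;
BCS 1997, proof of Prop. (21.15)). [cite: BurgisserClausenShokrollahi1997, Prop. (21.15)] -/
def hcVNPCover : MvPolynomial (HCVars m) k :=
  ∏ t : Fin (m + 2), ∑ i : Fin (m + 2), ∑ j : Fin (m + 2),
    X (Sum.inr (finProdFinEquiv (t, i))) *
      X (Sum.inr (finProdFinEquiv (finRotate (m + 2) t, j))) * X (Sum.inl (j, i))

/-- The `VNP` witness `G(X, Z) = α(Z) β(Z) · (Z_{(0,0)} · ∏_t ∑_{i,j} Z_{(t,i)} Z_{(t+1,j)} X_{(j,i)})`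
for `HC_{m+2}`: `HC_{m+2}(X) = ∑_{e ∈ {0,1}^{(m+2)²}} G(X, e)` (`boolSum_hcVNPWitness`;
BCS 1997, Prop. (21.15) with the position-matrix transcript in place of `ε_n`). [cite: BurgisserClausenShokrollahi1997, Prop. (21.15)] -/
def hcVNPWitness : MvPolynomial (HCVars m) k :=
  hcVNPAlpha m k * hcVNPBeta m k *
    (X (Sum.inr (finProdFinEquiv ((0 : Fin (m + 2)), (0 : Fin (m + 2))))) * hcVNPCover m k)

/-- **`HC_{m+2}` is the Boolean sum of the witness** over the position variables:
`∑_{e ∈ {0,1}^{(m+2)²}} G(X, e) = ∑_{σ, σ 0 = 0} ∏_t X_{σ(t+1), σ t} = HC_{m+2}(X)`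
(BCS 1997, Prop. (21.15): (A)–(D) for the recogniser, and the orbit description of
`n`-cycles). [cite: BurgisserClausenShokrollahi1997, Prop. (21.15)] -/
theorem boolSum_hcVNPWitness : boolSum (hcVNPWitness m k) = hcPoly (Fin (m + 2)) k := by
  unfold boolSum hcVNPWitness hcVNPAlpha hcVNPBeta hcVNPCover
  simp only [map_mul, map_prod, map_sum, map_sub, map_one, aeval_X, Sum.elim_inl, Sum.elim_inr]
  rw [← Equiv.sum_comp (Equiv.arrowCongr finProdFinEquiv (Equiv.refl Bool))]
  simp only [Equiv.arrowCongr_apply, Equiv.coe_refl, Function.comp_apply, id_eq,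
    Equiv.symm_apply_apply]
  refine (sum_recogniser_mul _).trans ?_
  -- at the permutation matrix of `σ` the cover factor `t` is `X_{σ(t+1), σ t}`
  have hC : ∀ σ : Perm (Fin (m + 2)), (∏ t, ∑ i, ∑ j,
      (if permGraph σ (t, i) = true then
          (1 : MvPolynomial (Fin (m + 2) × Fin (m + 2)) k) else 0) *
        (if permGraph σ (finRotate (m + 2) t, j) = true then 1 else 0) * X (j, i)) =
      ∏ t, X (σ (finRotate (m + 2) t), σ t) := by
    intro σ
    refine Finset.prod_congr rfl fun t _ => ?_
    simp only [permGraph, decide_eq_true_eq]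
    rw [Finset.sum_eq_single (σ t)]
    · rw [Finset.sum_eq_single (σ (finRotate (m + 2) t))]
      · simp
      · intro j _ hj
        rw [if_neg (Ne.symm hj), mul_zero, zero_mul]
      · simp
    · intro i _ hi
      simp [Ne.symm hi]
    · simp
  rw [Finset.sum_congr rfl fun σ _ => by rw [hC σ]]
  simp only [permGraph, decide_eq_true_eq, boole_mul]
  rw [← Finset.sum_filter, hcPoly, hamiltonianCycleSum_eq_sum_orderings]
  simp only [Matrix.mvPolynomialX_apply]

end Witness

/-! ### Size of the witness: variables, degree, complexity -/

section Bounds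

variable (m : ℕ) (k : Type u) [CommRing k]

/-- `deg α ≤ 2 (m+2)⁴` (at most `(m+2)⁴` factors of degree `2`). [cite: BurgisserClausenShokrollahi1997, Prop. (21.15)] -/
theorem totalDegree_hcVNPAlpha_le : (hcVNPAlpha m k).totalDegree ≤ (m + 2) ^ 4 * 2 := by
  unfold hcVNPAlpha
  refine (totalDegree_prod_le_of_le _ _ _ fun pq _ =>
    totalDegree_one_sub_X_mul_X_le _ _).trans ?_
  exact Nat.mul_le_mul_right 2 (card_conflictPairs_le _)

/-- `deg β ≤ m+2`. [cite: BurgisserClausenShokrollahi1997, Prop. (21.15)] -/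
theorem totalDegree_hcVNPBeta_le : (hcVNPBeta m k).totalDegree ≤ (m + 2) * 1 := by
  unfold hcVNPBeta
  refine (totalDegree_prod_le_of_le _ _ _ fun t _ =>
    totalDegree_sum_le_of_le _ _ _ fun i _ => totalDegree_X_le_one _).trans ?_
  simp

/-- `deg (cover) ≤ 3 (m+2)`. [cite: BurgisserClausenShokrollahi1997, Prop. (21.15)] -/
theorem totalDegree_hcVNPCover_le : (hcVNPCover m k).totalDegree ≤ (m + 2) * 3 := by
  unfold hcVNPCover
  refine (totalDegree_prod_le_of_le _ _ _ fun t _ => totalDegree_sum_le_of_le _ _ _ fun i _ =>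
    totalDegree_sum_le_of_le _ _ _ fun j _ => totalDegree_X_mul_X_mul_X_le _ _ _).trans ?_
  simp

/-- `deg G_{m+2} ≤ 7 (m+2)⁴` (BCS 1997, Prop. (21.15): the witness has polynomially bounded
degree). [cite: BurgisserClausenShokrollahi1997, Prop. (21.15)] -/
theorem totalDegree_hcVNPWitness_le : (hcVNPWitness m k).totalDegree ≤ 7 * (m + 2) ^ 4 := by
  have h1 := totalDegree_hcVNPAlpha_le m k
  have h2 := totalDegree_hcVNPBeta_le m k
  have h3 := totalDegree_hcVNPCover_le m k
  have h4 : (X (Sum.inr (finProdFinEquiv ((0 : Fin (m + 2)), (0 : Fin (m + 2))))) :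
      MvPolynomial (HCVars m) k).totalDegree ≤ 1 := totalDegree_X_le_one _
  have hp : m + 2 ≤ (m + 2) ^ 4 := Nat.le_self_pow (by norm_num) _
  unfold hcVNPWitness
  refine (totalDegree_mul _ _).trans ?_
  refine (add_le_add (totalDegree_mul _ _) (totalDegree_mul _ _)).trans ?_
  omega

/-- `L(α) ≤ 4 (m+2)⁴`. [cite: BurgisserClausenShokrollahi1997, Prop. (21.15)] -/
theorem complexity_hcVNPAlpha_le :
    complexity (hcVNPAlpha m k) ≤ (m + 2) ^ 4 * 3 + (m + 2) ^ 4 := by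
  unfold hcVNPAlpha
  refine (complexity_prod_le_of_le _ _ _ fun pq _ =>
    complexity_one_sub_X_mul_X_le _ _).trans ?_
  have h := card_conflictPairs_le (m + 2)
  gcongr

/-- `L(β) ≤ (m+2)² + (m+2)` (inputs are free). [cite: BurgisserClausenShokrollahi1997, Prop. (21.15)] -/
theorem complexity_hcVNPBeta_le :
    complexity (hcVNPBeta m k) ≤ (m + 2) * ((m + 2) * 0 + (m + 2)) + (m + 2) := by
  unfold hcVNPBeta
  refine (complexity_prod_le_of_le _ _ _ fun t _ => complexity_sum_le_of_le _ _ _ fun i _ =>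
    le_of_eq (complexity_X_holds (k := k) _)).trans ?_
  simp

/-- `L(cover) ≤ 3 (m+2)³ + (m+2)² + (m+2)`. [cite: BurgisserClausenShokrollahi1997, Prop. (21.15)] -/
theorem complexity_hcVNPCover_le :
    complexity (hcVNPCover m k) ≤
      (m + 2) * ((m + 2) * ((m + 2) * 2 + (m + 2)) + (m + 2)) + (m + 2) := by
  unfold hcVNPCover
  refine (complexity_prod_le_of_le _ _ _ fun t _ => complexity_sum_le_of_le _ _ _ fun i _ =>
    complexity_sum_le_of_le _ _ _ fun j _ => complexity_X_mul_X_mul_X_le _ _ _).trans ?_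
  simp

/-- `L(G_{m+2}) ≤ 8 (m+2)⁴` (BCS 1997, Prop. (21.15): `L(G_n) = O(n³)` there; here `O(n⁴)`
because of the `O(n⁴)` factors of `α`). [cite: BurgisserClausenShokrollahi1997, Prop. (21.15)] -/
theorem complexity_hcVNPWitness_le : complexity (hcVNPWitness m k) ≤ 8 * (m + 2) ^ 4 := by
  have h1 := complexity_hcVNPAlpha_le m k
  have h2 := complexity_hcVNPBeta_le m k
  have h3 := complexity_hcVNPCover_le m k
  have h4 := complexity_X_holds (k := k)
    (Sum.inr (finProdFinEquiv ((0 : Fin (m + 2)), (0 : Fin (m + 2)))) : HCVars m)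
  have h5 := complexity_mul_le_holds (hcVNPAlpha m k) (hcVNPBeta m k)
  have h6 := complexity_mul_le_holds
    (X (Sum.inr (finProdFinEquiv ((0 : Fin (m + 2)), (0 : Fin (m + 2))))) :
      MvPolynomial (HCVars m) k) (hcVNPCover m k)
  have h7 := complexity_mul_le_holds (hcVNPAlpha m k * hcVNPBeta m k)
    (X (Sum.inr (finProdFinEquiv ((0 : Fin (m + 2)), (0 : Fin (m + 2))))) * hcVNPCover m k)
  have e3 : (m + 2) ^ 3 = (m + 2) * (m + 2) * (m + 2) := by ring
  have e4 : (m + 2) ^ 4 = (m + 2) * (m + 2) * (m + 2) * (m + 2) := by ring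
  unfold hcVNPWitness
  nlinarith

end Bounds

/-! ### The witness family and `HC ∈ VNP` -/

section Family

variable (k : Type u) [CommRing k]

/-- The `VNP` witness family for `HC`: `hcVNPWitness` from `n = 2` on, and `0` for `n ≤ 1`, where
`HC_n = 0` (no permutation of `≤ 1` points has cycle type `{n}`). [cite: BurgisserClausenShokrollahi1997, Prop. (21.15)] -/
def hcVNPFamily : ∀ n : ℕ, MvPolynomial ((Fin n × Fin n) ⊕ Fin (n * n)) k
  | 0 => 0
  | 1 => 0
  | m + 2 => hcVNPWitness m k

/-- `HC_0 = HC_1 = 0`: every part of a cycle type is `≥ 2`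
(`Equiv.Perm.two_le_of_mem_cycleType`), so no permutation of `Fin n`, `n ≤ 1`, has cycle type
`{n}` (the edge convention of `Matrix.hamiltonianCycleSum`). [folklore] -/
theorem hcPoly_fin_eq_zero_of_le_one {n : ℕ} (hn : n ≤ 1) : hcPoly (Fin n) k = 0 := by
  unfold hcPoly Matrix.hamiltonianCycleSum
  refine Finset.sum_eq_zero fun π hπ => ?_
  exfalso
  rw [Finset.mem_filter] at hπ
  have h2 := Equiv.Perm.two_le_of_mem_cycleType (σ := π) (n := Fintype.card (Fin n))
    (by rw [hπ.2]; exact Multiset.mem_singleton_self _)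
  rw [Fintype.card_fin] at h2
  omega

/-- `HC_n` is the Boolean sum of the `n`-th witness, for every `n`. [cite: BurgisserClausenShokrollahi1997, Prop. (21.15)] -/
theorem boolSum_hcVNPFamily (n : ℕ) : boolSum (hcVNPFamily k n) = hcPoly (Fin n) k := by
  match n with
  | 0 =>
    rw [hcPoly_fin_eq_zero_of_le_one k (Nat.zero_le 1)]
    simp [hcVNPFamily, boolSum]
  | 1 =>
    rw [hcPoly_fin_eq_zero_of_le_one k le_rfl]
    simp [hcVNPFamily, boolSum]
  | m + 2 => exact boolSum_hcVNPWitness m k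

/-- **The witness family is in `VP`**: `2n²` variables, degree `≤ 7 n⁴`, complexity `≤ 8 n⁴`
(BCS 1997, proof of Prop. (21.15): `G ∈ VP`). [cite: BurgisserClausenShokrollahi1997, Prop. (21.15)] -/
theorem isVPFamily_hcVNPFamily : IsVPFamily (hcVNPFamily k) := by
  refine ⟨⟨(IsPBounded.iff_exists_le_mul_succ_pow _).2 ⟨2, 2, fun n => ?_⟩,
    (IsPBounded.iff_exists_le_mul_succ_pow _).2 ⟨7, 4, fun n => ?_⟩⟩,
    (IsPBounded.iff_exists_le_mul_succ_pow _).2 ⟨8, 4, fun n => ?_⟩⟩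
  · simp only [Fintype.card_sum, Fintype.card_prod, Fintype.card_fin]
    nlinarith
  · dsimp only
    match n with
    | 0 => simp [hcVNPFamily]
    | 1 => simp [hcVNPFamily]
    | m + 2 =>
      exact (totalDegree_hcVNPWitness_le m k).trans
        (Nat.mul_le_mul_left 7 (Nat.pow_le_pow_left (Nat.le_succ _) 4))
  · dsimp only
    match n with
    | 0 => rw [hcVNPFamily, ← C_0, complexity_C_holds]; exact Nat.zero_le _
    | 1 => rw [hcVNPFamily, ← C_0, complexity_C_holds]; exact Nat.zero_le _
    | m + 2 =>
      exact (complexity_hcVNPWitness_le m k).trans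
        (Nat.mul_le_mul_left 8 (Nat.pow_le_pow_left (Nat.le_succ _) 4))

/-- **`HC ∈ VNP` over every commutative ring** (Valiant 1979; BCS 1997, Prop. (21.15);
Bürgisser 2000, Thm. 2.10, membership half): the Hamiltonian cycle family is p-definable, with
witness `hcVNPFamily` and Boolean sum of length `n²`. [cite: BurgisserClausenShokrollahi1997, Prop. (21.15)] -/
theorem isVNPFamily_hcPoly_of_commRing : IsVNPFamily fun n => hcPoly (Fin n) k :=
  ⟨isPFamily_hcPoly_holds, fun n => n * n, hcVNPFamily k, isVPFamily_hcVNPFamily k,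
    fun n => (boolSum_hcVNPFamily k n).symm⟩

end Family

section FieldDischarge

variable (k : Type u) [Field k]

/-- **Discharge of `isVNPFamily_hcPoly`**: the Hamiltonian cycle family `(HC_n)_n` is
p-definable over every field (Valiant 1979; BCS 1997, Prop. (21.15); Bürgisser 2000, Thm. 2.10,
membership half). [cite: BurgisserClausenShokrollahi1997, Prop. (21.15)] -/
theorem isVNPFamily_hcPoly_holds : isVNPFamily_hcPoly k :=
  isVNPFamily_hcPoly_of_commRing k

/-- The bundled Hamiltonian cycle family lies in `VNP k` over every field
(`mem_VNP_ofFintype_iff_holds`; Valiant 1979; BCS 1997, Prop. (21.15)). [cite: BurgisserClausenShokrollahi1997, Prop. (21.15)] -/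
theorem hcFamily_mem_VNP : hcFamily k ∈ VNP k :=
  (mem_VNP_ofFintype_iff_holds _).2 (isVNPFamily_hcPoly_holds k)

end FieldDischarge

end Literature.Computability.AlgebraicComplexity
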